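import Literature.MathematicalPhysics.QuantumFieldTheory.Federbush1986.PhaseCellIVSection11Submanifold
import Literature.MathematicalPhysics.QuantumFieldTheory.Federbush1986.PhaseCellIVLatticeHierarchy

/-!
# `Federbush1986.PhaseCellIVGeomConstructions56Scaled` — [Federbush1988PhaseCellIV] §11 **Geometric Constructions 5 and 6**,
# (11.10)–(11.11) and (11.12)–(11.13) p. 338–339, AT PRINT'S OWN SCALE: on a hypercube `H` of level `r` (side `L_r`, any
# corner), with the singular point `x₀` of the Centering Property (`d(x₀, c(H)) ≤ L_{r+1}`) and the LITERAL factor `L_r/d(x, x₀)`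
# of (11.13) — transported from the unit-cube declarations of record (`GeomConstruction5`, `GeomConstruction6`, typed p314251,
# proved p323366 / p324300) along the dilation `y = L_r⁻¹(x − p)`; PROVED for every compact `C^∞` submanifold target
# `M ⊂ Rᵗ`, hypothesis-free for `U(N)`, `SU(N)`, `Ψ(ρ(G))`, the spheres; and stated on the §1 lattice hypercubes
# `PhaseCellIVLattice.cube N r n` with `L_r = edgeLen N r`, `c(H) = center N r n`, `CenteringProperty` (p314608)

statement-level skeleton of published theorems with citation tags; proofs where landed; nothing here is a claim about the Yang–Mills mass gap

CITATION HEADER.  P. Federbush, *A phase cell approach to Yang–Mills theory. IV. The choice of variables*, Commun. Math.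
Phys. **114** (1988) 317–343 [bib `Federbush1988PhaseCellIV`; doi:10.1007/bf01225039; lit store `paper:doi-10-1007-bf01225039`;
journal page = PDF page + 316], §11 «Gauge Interpolation» p. 338 [PDF 22] and p. 339 [PDF 23], read as images (renders
`run/shared/lean/pub/lit-balaban/lit-balaban-r19/renders/f4/f4-p022.png`, `f4-p023.png` of the held primary).  Cell `lit-balaban`,
reader/typer block **r19 gen 12** (F4 fold owner, `ROWS-F4.md`); SKELETON row **F4.Def§11** (definition row; cells Geometric
Constructions 5 and 6).  v1 p326102 (§§1–5); v1.1 APPEND-ONLY §6 (the converse and the two equivalences).  Companion of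
`PhaseCellIVGaugeInterpolation` §5 (the unit-scale decls `PhaseCellIVGauge.GeomConstruction5` / `GeomConstruction6`, p314251), `PhaseCellIVGeomConstruction5` (p323366), `PhaseCellIVGeomConstruction6` (p324300),
`PhaseCellIVGeomConstruction3` (p299713: Construction 3 typed at every scale, `scaledCube`), `PhaseCellIVLatticeHierarchy` (§1,
p314608: `edgeLen`, `cube`, `center`, `CenteringProperty`).

WHAT IS PRINTED (p. 338–339, verbatim).  «As a final extension we assume `φ′(x)` defined on the boundary of hypercube `H`,
i.e. on `∂H`.  We discuss extending `φ′(x)` to `H`. … In this case we modify this `ᵉφ′(x)` defined on `H` to `ᵉˢφ′(x)` defined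
on `H` … *Geometric Construction 5.* `ᵉˢφ′(x)` satisfies a) `ᵉˢφ′(x) = ᵉφ′(x)`, `x ∈ ∂H`, (11.10) b) `|D^α ᵉˢφ′(x)| ≤ c_α
(1/(d(x, ∂D))^{|α|−1}) Λ₁(ᵉφ′)`, (11.11) where the norm on derivatives in the left side of (11.11) is any reasonable `L_∞`
norm.  We finally consider `φ′(x)` defined on `∂H` of hypercube `H` where `φ′` is not a homotopically trivial map from `∂H` to
`G`.  In this case we find an extension, discontinuous at one point `x₀`.  `x₀` is picked as a point in `H` with the following
property: *Centering Property.* With `H` level `r`, `d(x₀, c(H)) ≤ L_{r+1}`, … where `c(H_i)` is the center of `H_i`.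
*Geometric Construction 6.* `ᵉφ′(x)` defined on `H − x₀`, as an extension of `φ′(x)` defined on `∂H`, satisfies a) `ᵉφ′(x) =
φ′(x)`, `x ∈ ∂H`, (11.12) b) `|D^α ᵉφ′(x)| ≤ c_α · Max(1/(d(x, ∂D))^{|α|−1}, 1/(d(x, x₀))^{|α|−1}) · (L_r/d(x, x₀)) · Λ₁(φ′)`.
(11.13)»; p. 339: «*Caution.* The geometric theorems of Appendix A, require a universal bound on `Λ₁` of `φ`'s (as scaled
to unit scale) and it is important to check our construction maintains such where we use these theorems.»

WHAT THIS FILE DOES.  The decls of record `GeomConstruction5 k t M` / `GeomConstruction6 k t M δ` type (11.10)–(11.13) «as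
scaled to unit scale» (`H` = the unit `k`-cube, `L_r = 1`, `d(x₀, c(H)) ≤ δ`).  Here the two constructions are typed ON A
HYPERCUBE OF SIDE `ℓ = L_r` with lowest corner `p` (`hypercube k p ℓ = p + [0, ℓ]ᵏ`), the cap of the Caution in its
scale-invariant form `L_r·Λ₁ ≤ c₁` (as Construction 3 is typed in `PhaseCellIVGeomConstruction3`), the singular point with
`d(x₀, c(H)) ≤ δ·L_r`, and (11.13) with its printed factor `L_r/d(x, x₀)`:
* `GeomConstruction5Scaled k t M`, `GeomConstruction6Scaled k t M δ` (`Prop`-valued, PROVED below for print's targets);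
* **`GeomConstruction5.scaled`**, **`GeomConstruction6.scaled`**: the unit-scale decls IMPLY the scaled ones with THE SAME
  constants `c_α` — pull the datum back along `y ↦ p + ℓy` (`Λ₁` becomes `ℓΛ₁ ≤ c₁`, the unit cap), extend/smooth at unit
  scale, push forward along `x ↦ ℓ⁻¹(x − p)`; each derivative gains `ℓ⁻¹` (`norm_iteratedFDeriv_comp_affine_le`), `d(·, ∂H)`
  and `d(·, x₀)` gain `ℓ` (Mathlib `infDist_smul₀`, `dist_smul₀`), and the powers of `ℓ` cancel EXACTLY to print's (11.11) (no
  `L_r`) and (11.13) (one `L_r/d(x, x₀)`) — i.e. the unit-scale typing of record loses nothing;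
* `geomConstruction5Scaled_of_submanifold` / `geomConstruction6Scaled_of_submanifold` (every compact `C^∞` submanifold
  `M ⊂ Rᵗ`, every `k`, every `δ < ½`), `geomConstructions56Scaled_of_isCompact_subgroup`, `…_range_of_compact`,
  `…_unitaryGroup`, `…_specialUnitaryGroup`, `…_sphere` (hypothesis-free);
* the §1 LATTICE FORM: `PhaseCellIVLattice.cube N r n = hypercube d (pos N r n) (edgeLen N r)` and `center N r n = pos N r n +
  L_r • (½, …, ½)` (`cube_eq_hypercube`, `center_eq`), the Centering Property gives `d(x₀, c(H)) ≤ L_{r+1} = N⁻¹·L_r`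
  (`dist_center_le_of_centeringProperty`), so for `N ≥ 3` (print: «`N` odd») Construction 6 holds on every level-`r` hypercube of
  `ℒ^r` with print's `x₀` (`geomConstruction6_cube_of_scaled`, `geomConstruction6Scaled_lattice_of_submanifold`,
  **`geomConstruction6_cube_unitaryGroup`** / `geomConstruction6_cube_specialUnitaryGroup` — the literal (11.12)–(11.13) on
  `H = cube N r n`, hypothesis-free beyond `N ≥ 3`), and Construction 5 likewise (`geomConstruction5_cube_of_scaled`,
  `geomConstruction5_cube_unitaryGroup`, every `N ≥ 1`);
* (v1.1, §6) the CONVERSE at `p = 0`, `ℓ = 1` (`GeomConstruction5Scaled.unit`, `GeomConstruction6Scaled.unit`), hence the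
  EQUIVALENCES `geomConstruction5Scaled_iff : GeomConstruction5Scaled k t M ↔ GeomConstruction5 k t M` and
  `geomConstruction6Scaled_iff : GeomConstruction6Scaled k t M δ ↔ GeomConstruction6 k t M δ` — print's scaled statements and
  the unit-scale decls of record say the same thing («as scaled to unit scale», p. 339).

WHAT THIS MODULE PROVIDES (namespace `PhaseCellIVGauge`): defs with bodies `hypercube`, `hypercubeBoundary`, `Hypercube.toUnit`,
`Hypercube.ofUnit`, `Hypercube.chart`; `Prop`-valued defs `GeomConstruction5Scaled`, `GeomConstruction6Scaled` (both PROVED for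
every target print uses — no named fact is introduced); the dictionary lemmas of `Hypercube` (`mem_hypercube_iff`,
`hypercubeBoundary_eq_preimage`, `interior_hypercube_eq_preimage`, `infDist_toUnit_cubeBoundary`, `scale_bookkeeping5/6`, …);
the theorems listed above.  Axioms standard.
-/

namespace Literature.MathematicalPhysics.QuantumFieldTheory.Federbush1986

noncomputable section

open Metric Set Function
open scoped ContDiff Topology NNReal Pointwise

namespace PhaseCellIVGauge

open LipschitzMollifier (Euc)
open PhaseCellIVAppA
open Literature.AlgebraicGeometry.RealAlgebraic Literature.Analysis.Calculus

variable {k t : ℕ}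

/-! ## §1 The hypercube `H = p + [0, ℓ]ᵏ` of side `ℓ = L_r`, its boundary `∂H`, and the chart «as scaled to unit scale» -/

/-- The hypercube `H` with lowest corner `p` and side `ℓ`: `{p_i ≤ x_i ≤ p_i + ℓ}` (print's «hypercube `H`», of level `r`,
side `ℓ = L_r`, p. 338; for `p = 0` this is `scaledCube k ℓ` of `PhaseCellIVGeomConstruction3`, for `p = n/N^r`, `ℓ = 1/N^r`
the lattice hypercube `PhaseCellIVLattice.cube N r n`). [cite: Federbush1988PhaseCellIV, §11 Geometric Constructions 5–6 p. 338] -/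
def hypercube (k : ℕ) (p : EuclideanSpace ℝ (Fin k)) (ℓ : ℝ) : Set (EuclideanSpace ℝ (Fin k)) :=
  {x | ∀ i, x i ∈ Icc (p i) (p i + ℓ)}

/-- `∂H`, «the boundary of hypercube `H`» (p. 338). [cite: Federbush1988PhaseCellIV, (11.10), (11.12) p. 338] -/
def hypercubeBoundary (k : ℕ) (p : EuclideanSpace ℝ (Fin k)) (ℓ : ℝ) : Set (EuclideanSpace ℝ (Fin k)) :=
  frontier (hypercube k p ℓ)

/-- `H` is closed. [cite: Federbush1988PhaseCellIV, §11 p. 338] -/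
theorem isClosed_hypercube (k : ℕ) (p : EuclideanSpace ℝ (Fin k)) (ℓ : ℝ) : IsClosed (hypercube k p ℓ) := by
  have : hypercube k p ℓ = ⋂ i, (fun x : EuclideanSpace ℝ (Fin k) => x i) ⁻¹' Icc (p i) (p i + ℓ) := by
    ext x; simp [hypercube]
  rw [this]
  exact isClosed_iInter fun i => isClosed_Icc.preimage (by fun_prop)

/-- `∂H ⊆ H`. [cite: Federbush1988PhaseCellIV, (11.10) p. 338] -/
theorem hypercubeBoundary_subset (k : ℕ) (p : EuclideanSpace ℝ (Fin k)) (ℓ : ℝ) : hypercubeBoundary k p ℓ ⊆ hypercube k p ℓ :=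
  frontier_subset_closure.trans (isClosed_hypercube k p ℓ).closure_subset

/-- For the corner `p = 0` the hypercube is the cube `D_ℓ` of Construction 3's typing. [cite: Federbush1988PhaseCellIV, §11
Geometric Construction 3 p. 338] -/
theorem hypercube_zero (k : ℕ) (ℓ : ℝ) : hypercube k 0 ℓ = scaledCube k ℓ := by
  ext x; simp [hypercube, scaledCube]

namespace Hypercube

/-- «as scaled to unit scale» (p. 339): the chart `x ↦ ℓ⁻¹(x − p)` taking `H` onto the unit cube `D`.
[cite: Federbush1988PhaseCellIV, §11 Caution p. 339] -/
def toUnit (p : Euc k) (ℓ : ℝ) (x : Euc k) : Euc k := ℓ⁻¹ • (x - p)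

/-- The inverse chart `y ↦ p + ℓy` taking `D` onto `H`. [cite: Federbush1988PhaseCellIV, §11 Caution p. 339] -/
def ofUnit (p : Euc k) (ℓ : ℝ) (y : Euc k) : Euc k := p + ℓ • y

/-- Coordinates of the chart. [cite: Federbush1988PhaseCellIV, §11 Caution p. 339] -/
@[simp] theorem toUnit_apply (p : Euc k) (ℓ : ℝ) (x : Euc k) (i : Fin k) : toUnit p ℓ x i = ℓ⁻¹ * (x i - p i) := by
  simp [toUnit]

/-- Coordinates of the inverse chart. [cite: Federbush1988PhaseCellIV, §11 Caution p. 339] -/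
@[simp] theorem ofUnit_apply (p : Euc k) (ℓ : ℝ) (y : Euc k) (i : Fin k) : ofUnit p ℓ y i = p i + ℓ * y i := by
  simp [ofUnit]

/-- `p + ℓ·ℓ⁻¹(x − p) = x`. [cite: Federbush1988PhaseCellIV, §11 Caution p. 339] -/
@[simp] theorem ofUnit_toUnit {ℓ : ℝ} (hℓ : ℓ ≠ 0) (p x : Euc k) : ofUnit p ℓ (toUnit p ℓ x) = x := by
  simp [ofUnit, toUnit, smul_smul, mul_inv_cancel₀ hℓ]

/-- `ℓ⁻¹((p + ℓy) − p) = y`. [cite: Federbush1988PhaseCellIV, §11 Caution p. 339] -/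
@[simp] theorem toUnit_ofUnit {ℓ : ℝ} (hℓ : ℓ ≠ 0) (p y : Euc k) : toUnit p ℓ (ofUnit p ℓ y) = y := by
  simp [ofUnit, toUnit, smul_smul, inv_mul_cancel₀ hℓ]

/-- The chart is injective. [cite: Federbush1988PhaseCellIV, §11 Caution p. 339] -/
theorem toUnit_injective {ℓ : ℝ} (hℓ : ℓ ≠ 0) (p : Euc k) : Injective (toUnit p ℓ) :=
  (LeftInverse.injective fun x => ofUnit_toUnit hℓ p x)

/-- The chart is surjective. [cite: Federbush1988PhaseCellIV, §11 Caution p. 339] -/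
theorem toUnit_surjective {ℓ : ℝ} (hℓ : ℓ ≠ 0) (p : Euc k) : Surjective (toUnit p ℓ) :=
  RightInverse.surjective fun y => toUnit_ofUnit hℓ p y

/-- The chart is the affine map `x ↦ ℓ⁻¹x + (−ℓ⁻¹p)`. [cite: Federbush1988PhaseCellIV, §11 Caution p. 339] -/
theorem toUnit_eq_affine (p : Euc k) (ℓ : ℝ) (x : Euc k) : toUnit p ℓ x = ℓ⁻¹ • x + -(ℓ⁻¹ • p) := by
  simp [toUnit, sub_eq_add_neg]

/-- The chart is continuous. [cite: Federbush1988PhaseCellIV, §11 Caution p. 339] -/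
theorem continuous_toUnit (p : Euc k) (ℓ : ℝ) : Continuous (toUnit p ℓ) := by
  show Continuous fun x : Euc k => ℓ⁻¹ • (x - p)
  fun_prop

/-- The inverse chart is continuous. [cite: Federbush1988PhaseCellIV, §11 Caution p. 339] -/
theorem continuous_ofUnit (p : Euc k) (ℓ : ℝ) : Continuous (ofUnit p ℓ) := by
  show Continuous fun y : Euc k => p + ℓ • y
  fun_prop

/-- The chart is `C^∞` (affine). [cite: Federbush1988PhaseCellIV, §11 Caution p. 339] -/
theorem contDiff_toUnit (p : Euc k) (ℓ : ℝ) : ContDiff ℝ ∞ (toUnit p ℓ) := by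
  show ContDiff ℝ ∞ fun x : Euc k => ℓ⁻¹ • (x - p)
  fun_prop

/-- Distances scale by `ℓ⁻¹` under the chart. [cite: Federbush1988PhaseCellIV, §11 Caution p. 339] -/
theorem dist_toUnit {ℓ : ℝ} (hℓ : 0 < ℓ) (p x x' : Euc k) : dist (toUnit p ℓ x) (toUnit p ℓ x') = ℓ⁻¹ * dist x x' := by
  rw [toUnit, toUnit, dist_smul₀, dist_sub_right, norm_inv, Real.norm_of_nonneg hℓ.le]

/-- … and by `ℓ` under its inverse. [cite: Federbush1988PhaseCellIV, §11 Caution p. 339] -/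
theorem dist_ofUnit {ℓ : ℝ} (hℓ : 0 < ℓ) (p y y' : Euc k) : dist (ofUnit p ℓ y) (ofUnit p ℓ y') = ℓ * dist y y' := by
  rw [ofUnit, ofUnit, dist_add_left, dist_smul₀, Real.norm_of_nonneg hℓ.le]

/-- The chart as a homeomorphism of `ℝᵏ`. [cite: Federbush1988PhaseCellIV, §11 Caution p. 339] -/
def chart (p : Euc k) {ℓ : ℝ} (hℓ : ℓ ≠ 0) : Euc k ≃ₜ Euc k where
  toFun := toUnit p ℓ
  invFun := ofUnit p ℓ
  left_inv x := ofUnit_toUnit hℓ p x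
  right_inv y := toUnit_ofUnit hℓ p y
  continuous_toFun := continuous_toUnit p ℓ
  continuous_invFun := continuous_ofUnit p ℓ

/-- The homeomorphism is the chart. [cite: Federbush1988PhaseCellIV, §11 Caution p. 339] -/
@[simp] theorem chart_apply (p : Euc k) {ℓ : ℝ} (hℓ : ℓ ≠ 0) (x : Euc k) : chart p hℓ x = toUnit p ℓ x := rfl

/-- «as scaled to unit scale»: `x ∈ H ↔ ℓ⁻¹(x − p) ∈ D`. [cite: Federbush1988PhaseCellIV, §11 Caution p. 339] -/
theorem mem_hypercube_iff {ℓ : ℝ} (hℓ : 0 < ℓ) (p x : Euc k) : x ∈ hypercube k p ℓ ↔ toUnit p ℓ x ∈ unitCube k := by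
  simp only [hypercube, unitCube, mem_setOf_eq, toUnit_apply, mem_Icc]
  refine forall_congr' fun i => ?_
  rw [mul_nonneg_iff_of_pos_left (inv_pos.mpr hℓ), inv_mul_le_one₀ hℓ, sub_nonneg, sub_le_iff_le_add']

/-- `H` is the preimage of the unit cube under the chart. [cite: Federbush1988PhaseCellIV, §11 Caution p. 339] -/
theorem hypercube_eq_preimage {ℓ : ℝ} (hℓ : 0 < ℓ) (p : Euc k) : hypercube k p ℓ = toUnit p ℓ ⁻¹' unitCube k :=
  Set.ext fun x => mem_hypercube_iff hℓ p x

/-- `∂H` is the preimage of `∂D` under the chart (a homeomorphism). [cite: Federbush1988PhaseCellIV, §11 Caution p. 339] -/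
theorem hypercubeBoundary_eq_preimage {ℓ : ℝ} (hℓ : 0 < ℓ) (p : Euc k) :
    hypercubeBoundary k p ℓ = toUnit p ℓ ⁻¹' cubeBoundary k := by
  rw [hypercubeBoundary, hypercube_eq_preimage hℓ, cubeBoundary, show toUnit p ℓ = ⇑(chart p hℓ.ne') from rfl,
    Homeomorph.preimage_frontier]

/-- The open hypercube is the preimage of the open unit cube. [cite: Federbush1988PhaseCellIV, §11 Caution p. 339] -/
theorem interior_hypercube_eq_preimage {ℓ : ℝ} (hℓ : 0 < ℓ) (p : Euc k) :
    interior (hypercube k p ℓ) = toUnit p ℓ ⁻¹' interior (unitCube k) := by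
  rw [hypercube_eq_preimage hℓ, show toUnit p ℓ = ⇑(chart p hℓ.ne') from rfl, Homeomorph.preimage_interior]

/-- `x ∈ ∂H ↔ ℓ⁻¹(x − p) ∈ ∂D`. [cite: Federbush1988PhaseCellIV, §11 Caution p. 339] -/
theorem mem_hypercubeBoundary_iff {ℓ : ℝ} (hℓ : 0 < ℓ) (p x : Euc k) :
    x ∈ hypercubeBoundary k p ℓ ↔ toUnit p ℓ x ∈ cubeBoundary k := by
  rw [hypercubeBoundary_eq_preimage hℓ]; rfl

/-- `x ∈ H° ↔ ℓ⁻¹(x − p) ∈ D°`. [cite: Federbush1988PhaseCellIV, §11 Caution p. 339] -/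
theorem mem_interior_hypercube_iff {ℓ : ℝ} (hℓ : 0 < ℓ) (p x : Euc k) :
    x ∈ interior (hypercube k p ℓ) ↔ toUnit p ℓ x ∈ interior (unitCube k) := by
  rw [interior_hypercube_eq_preimage hℓ]; rfl

/-- `y ∈ ∂D ↔ p + ℓy ∈ ∂H`. [cite: Federbush1988PhaseCellIV, §11 Caution p. 339] -/
theorem ofUnit_mem_hypercubeBoundary_iff {ℓ : ℝ} (hℓ : 0 < ℓ) (p y : Euc k) :
    ofUnit p ℓ y ∈ hypercubeBoundary k p ℓ ↔ y ∈ cubeBoundary k := by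
  rw [mem_hypercubeBoundary_iff hℓ, toUnit_ofUnit hℓ.ne']

/-- `∂D` is the image of `∂H` under the chart. [cite: Federbush1988PhaseCellIV, §11 Caution p. 339] -/
theorem image_hypercubeBoundary {ℓ : ℝ} (hℓ : 0 < ℓ) (p : Euc k) : toUnit p ℓ '' hypercubeBoundary k p ℓ = cubeBoundary k := by
  rw [hypercubeBoundary_eq_preimage hℓ, image_preimage_eq _ (toUnit_surjective hℓ.ne' p)]

/-- Distances to sets scale by `ℓ⁻¹` under the chart. [cite: Federbush1988PhaseCellIV, §11 Caution p. 339; (11.11), (11.13)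
p. 338–339 (`d(x, ∂D)`)] -/
theorem infDist_toUnit_image {ℓ : ℝ} (hℓ : 0 < ℓ) (p x : Euc k) (S : Set (Euc k)) :
    infDist (toUnit p ℓ x) (toUnit p ℓ '' S) = ℓ⁻¹ * infDist x S := by
  have h1 : toUnit p ℓ '' S = ℓ⁻¹ • ((fun z : Euc k => z - p) '' S) := by
    rw [← image_smul, image_image]; rfl
  have hiso : Isometry fun z : Euc k => z - p := Isometry.of_dist_eq fun a b => dist_sub_right a b p
  have h2 : infDist (x - p) ((fun z : Euc k => z - p) '' S) = infDist x S := Metric.infDist_image hiso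
  rw [h1, show toUnit p ℓ x = ℓ⁻¹ • (x - p) from rfl, infDist_smul₀ (inv_ne_zero hℓ.ne'), h2, norm_inv,
    Real.norm_of_nonneg hℓ.le]

/-- `d(ℓ⁻¹(x − p), ∂D) = ℓ⁻¹ d(x, ∂H)`. [cite: Federbush1988PhaseCellIV, (11.11), (11.13) p. 338–339; Caution p. 339] -/
theorem infDist_toUnit_cubeBoundary {ℓ : ℝ} (hℓ : 0 < ℓ) (p x : Euc k) :
    infDist (toUnit p ℓ x) (cubeBoundary k) = ℓ⁻¹ * infDist x (hypercubeBoundary k p ℓ) := by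
  rw [← image_hypercubeBoundary hℓ p, infDist_toUnit_image hℓ]

/-- The centre `c(H) = p + ℓ·(½, …, ½)` goes to the centre of `D`. [cite: Federbush1988PhaseCellIV, Centering Property p. 338] -/
theorem toUnit_center {ℓ : ℝ} (hℓ : ℓ ≠ 0) (p : Euc k) : toUnit p ℓ (p + ℓ • CubeBall.center k) = CubeBall.center k :=
  toUnit_ofUnit hℓ p _

end Hypercube

open Hypercube

/-! ## §2 Geometric Constructions 5 and 6 typed on a hypercube of side `ℓ = L_r` -/

/-- **Geometric Construction 5 at print's scale** (p. 338 (11.10)–(11.11), with the Caution p. 339): for every cap `c₁` there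
are constants `c_m = c_m(c₁)` such that for every hypercube `H = p + [0, ℓ]ᵏ` (`ℓ = L_r > 0`) and every `ᵉφ′ : H → M` with a
Lipschitz constant `K`, `ℓ·K ≤ c₁` («a universal bound on `Λ₁` … as scaled to unit scale»), there is `ᵉˢφ′ : ℝᵏ → Rᵗ` with values
in `M` on `H`, continuous on `H`, `C^∞` on the open hypercube, a) `ᵉˢφ′ = ᵉφ′` on `∂H` (11.10), b) `‖D^m ᵉˢφ′(x)‖ ≤ c_m
d(x, ∂H)^{−(m−1)} K` for every `m ≥ 1` (11.11) (no power of `L_r`, as printed).  Embedded reading (target a set `M ⊆ Rᵗ`), as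
every Appendix-A file.  `Prop`-valued; proved below for print's targets. [cite: Federbush1988PhaseCellIV, Geometric
Construction 5 (11.10)–(11.11) p. 338; Caution p. 339] -/
def GeomConstruction5Scaled (k t : ℕ) (M : Set (EuclideanSpace ℝ (Fin t))) : Prop :=
  ∀ c₁ : ℝ≥0, ∃ c : ℕ → ℝ, ∀ (p : EuclideanSpace ℝ (Fin k)) (ℓ : ℝ), 0 < ℓ →
    ∀ eφ : ↥(hypercube k p ℓ) → ↥M, (∃ K : ℝ≥0, ℓ * K ≤ c₁ ∧ LipschitzWith K eφ) →
      ∃ esφ : EuclideanSpace ℝ (Fin k) → EuclideanSpace ℝ (Fin t),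
        MapsTo esφ (hypercube k p ℓ) M ∧
        (∀ x : ↥(hypercubeBoundary k p ℓ), esφ x = (eφ ⟨x.1, hypercubeBoundary_subset k p ℓ x.2⟩ : EuclideanSpace ℝ (Fin t))) ∧
        ContinuousOn esφ (hypercube k p ℓ) ∧
        ContDiffOn ℝ ∞ esφ (interior (hypercube k p ℓ)) ∧
        ∀ m : ℕ, 1 ≤ m → ∀ K : ℝ≥0, ℓ * K ≤ c₁ → LipschitzWith K eφ →
          ∀ x ∈ interior (hypercube k p ℓ),
            ‖iteratedFDeriv ℝ m esφ x‖ ≤ c m * ((infDist x (hypercubeBoundary k p ℓ))⁻¹ ^ (m - 1)) * K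

/-- **Geometric Construction 6 at print's scale** (p. 338–339 (11.12)–(11.13), with the Centering Property and the Caution):
for every cap `c₁` there are constants `c_m = c_m(c₁, δ)` such that for every hypercube `H = p + [0, ℓ]ᵏ` of side `ℓ = L_r > 0`,
every singular point `x₀` with `d(x₀, c(H)) ≤ δ·L_r` (print: `δ·L_r = L_{r+1}`, `c(H) = p + L_r(½, …, ½)`), and every
`φ′ : ∂H → M` with a Lipschitz constant `K`, `ℓ·K ≤ c₁`, there is `ᵉφ′ : ℝᵏ → Rᵗ` with values in `M` on `H − x₀`, continuous
there, `C^∞` on the open hypercube minus `x₀`, a) `ᵉφ′ = φ′` on `∂H` (11.12), b) `‖D^m ᵉφ′(x)‖ ≤ c_m · max(d(x, ∂H)^{−(m−1)},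
d(x, x₀)^{−(m−1)}) · (L_r/d(x, x₀)) · K` for every `m ≥ 1` — (11.13) WITH ITS PRINTED FACTOR `L_r/d(x, x₀)`.  Embedded reading.
`Prop`-valued; proved below for print's targets. [cite: Federbush1988PhaseCellIV, Geometric Construction 6 (11.12)–(11.13)
p. 338–339; Centering Property p. 338; Caution p. 339] -/
def GeomConstruction6Scaled (k t : ℕ) (M : Set (EuclideanSpace ℝ (Fin t))) (δ : ℝ) : Prop :=
  ∀ c₁ : ℝ≥0, ∃ c : ℕ → ℝ, ∀ (p : EuclideanSpace ℝ (Fin k)) (ℓ : ℝ), 0 < ℓ →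
    ∀ x₀ : EuclideanSpace ℝ (Fin k), dist x₀ (p + ℓ • CubeBall.center k) ≤ δ * ℓ →
      ∀ φ : ↥(hypercubeBoundary k p ℓ) → ↥M, (∃ K : ℝ≥0, ℓ * K ≤ c₁ ∧ LipschitzWith K φ) →
        ∃ eφ : EuclideanSpace ℝ (Fin k) → EuclideanSpace ℝ (Fin t),
          MapsTo eφ (hypercube k p ℓ \ {x₀}) M ∧
          (∀ x : ↥(hypercubeBoundary k p ℓ), eφ x = (φ x : EuclideanSpace ℝ (Fin t))) ∧
          ContinuousOn eφ (hypercube k p ℓ \ {x₀}) ∧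
          ContDiffOn ℝ ∞ eφ (interior (hypercube k p ℓ) \ {x₀}) ∧
          ∀ m : ℕ, 1 ≤ m → ∀ K : ℝ≥0, ℓ * K ≤ c₁ → LipschitzWith K φ →
            ∀ x ∈ interior (hypercube k p ℓ) \ {x₀},
              ‖iteratedFDeriv ℝ m eφ x‖ ≤
                c m * max ((infDist x (hypercubeBoundary k p ℓ))⁻¹ ^ (m - 1)) ((dist x x₀)⁻¹ ^ (m - 1)) *
                  (ℓ / dist x x₀) * K

/-! ## §3 The transport from unit scale: the powers of `L_r` cancel exactly to (11.11) and (11.13) -/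

namespace Hypercube

/-- Pull-back of a datum on `H` to the unit cube multiplies Lipschitz constants by `ℓ`.
[cite: Federbush1988PhaseCellIV, §11 Caution p. 339] -/
theorem lipschitzWith_comp_ofUnit_cube {ℓ : ℝ} (hℓ : 0 < ℓ) (p : Euc k) {M : Set (Euc t)} {eφ : ↥(hypercube k p ℓ) → ↥M}
    {K : ℝ≥0} (hK : LipschitzWith K eφ) :
    LipschitzWith (K * Real.toNNReal ℓ)
      (fun y : ↥(unitCube k) => eφ ⟨ofUnit p ℓ y.1, (mem_hypercube_iff hℓ p _).2 ((toUnit_ofUnit hℓ.ne' p y.1).symm ▸ y.2)⟩) := by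
  refine hK.comp (LipschitzWith.of_dist_le_mul fun y y' => ?_)
  rw [Subtype.dist_eq, Subtype.dist_eq y]
  show dist (ofUnit p ℓ y.1) (ofUnit p ℓ y'.1) ≤ Real.toNNReal ℓ * dist y.1 y'.1
  rw [dist_ofUnit hℓ, Real.coe_toNNReal _ hℓ.le]

/-- Same on the boundary. [cite: Federbush1988PhaseCellIV, §11 Caution p. 339] -/
theorem lipschitzWith_comp_ofUnit_boundary {ℓ : ℝ} (hℓ : 0 < ℓ) (p : Euc k) {M : Set (Euc t)}
    {φ : ↥(hypercubeBoundary k p ℓ) → ↥M} {K : ℝ≥0} (hK : LipschitzWith K φ) :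
    LipschitzWith (K * Real.toNNReal ℓ)
      (fun y : ↥(cubeBoundary k) => φ ⟨ofUnit p ℓ y.1, (ofUnit_mem_hypercubeBoundary_iff hℓ p y.1).2 y.2⟩) := by
  refine hK.comp (LipschitzWith.of_dist_le_mul fun y y' => ?_)
  rw [Subtype.dist_eq, Subtype.dist_eq y]
  show dist (ofUnit p ℓ y.1) (ofUnit p ℓ y'.1) ≤ Real.toNNReal ℓ * dist y.1 y'.1
  rw [dist_ofUnit hℓ, Real.coe_toNNReal _ hℓ.le]

/-- The scale-invariant cap `ℓK ≤ c₁` is the unit cap of the pulled-back datum. [cite: Federbush1988PhaseCellIV, §11 Caution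
p. 339] -/
theorem cap_toNNReal {ℓ : ℝ} (hℓ : 0 < ℓ) {K c₁ : ℝ≥0} (h : ℓ * K ≤ c₁) : K * Real.toNNReal ℓ ≤ c₁ := by
  rw [← NNReal.coe_le_coe, NNReal.coe_mul, Real.coe_toNNReal _ hℓ.le, mul_comm]
  exact h

/-- Affine transport of derivative bounds along the chart: `‖D^m(f ∘ toUnit)(x)‖ ≤ ℓ⁻ᵐ ‖D^m f(toUnit x)‖`.
[cite: Federbush1988PhaseCellIV, (11.11), (11.13) p. 338–339; Caution p. 339] -/
theorem norm_iteratedFDeriv_comp_toUnit_le {ℓ : ℝ} (hℓ : 0 < ℓ) (p : Euc k) {f : Euc k → Euc t} {s : Set (Euc k)}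
    (hs : IsOpen s) (hf : ContDiffOn ℝ ∞ f s) (x : Euc k) (hx : toUnit p ℓ x ∈ s) (m : ℕ) :
    ‖iteratedFDeriv ℝ m (fun y => f (toUnit p ℓ y)) x‖ ≤ ℓ⁻¹ ^ m * ‖iteratedFDeriv ℝ m f (toUnit p ℓ x)‖ := by
  have hfun : (fun y => f (toUnit p ℓ y)) = fun y => f (ℓ⁻¹ • y + -(ℓ⁻¹ • p)) := by
    funext y; rw [toUnit_eq_affine]
  have hx' : ℓ⁻¹ • x + -(ℓ⁻¹ • p) ∈ s := by rwa [← toUnit_eq_affine]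
  have h := norm_iteratedFDeriv_comp_affine_le hs hf ℓ⁻¹ (-(ℓ⁻¹ • p)) x hx' m
  rw [← toUnit_eq_affine, abs_of_pos (inv_pos.2 hℓ)] at h
  rwa [hfun]

/-- The bookkeeping of (11.11): `ℓ⁻ᵐ · c · (ℓ⁻¹a)^{−(m−1)} · (ℓK) = c · a^{−(m−1)} · K` (`m ≥ 1`).
[cite: Federbush1988PhaseCellIV, (11.11) p. 338] -/
theorem scale_bookkeeping5 {ℓ : ℝ} (hℓ : 0 < ℓ) (C a K : ℝ) {m : ℕ} (hm : 1 ≤ m) :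
    ℓ⁻¹ ^ m * (C * (ℓ⁻¹ * a)⁻¹ ^ (m - 1) * (ℓ * K)) = C * a⁻¹ ^ (m - 1) * K := by
  obtain ⟨m, rfl⟩ := Nat.exists_eq_add_of_le' hm
  have hℓ0 : ℓ ≠ 0 := hℓ.ne'
  simp only [Nat.add_sub_cancel, mul_inv, inv_inv, mul_pow]
  have h1 : ℓ⁻¹ ^ (m + 1) * (ℓ ^ m * ℓ) = 1 := by
    rw [← pow_succ, ← mul_pow, inv_mul_cancel₀ hℓ0, one_pow]
  calc _ = ℓ⁻¹ ^ (m + 1) * (ℓ ^ m * ℓ) * (C * a⁻¹ ^ m * K) := by ring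
    _ = C * a⁻¹ ^ m * K := by rw [h1, one_mul]

/-- The bookkeeping of (11.13): `ℓ⁻ᵐ · c · max((ℓ⁻¹a)^{−(m−1)}, (ℓ⁻¹b)^{−(m−1)}) · (ℓ⁻¹b)⁻¹ · (ℓK) = c · max(a^{−(m−1)},
b^{−(m−1)}) · (ℓ/b) · K` (`m ≥ 1`) — exactly one factor `L_r/d(x, x₀)` survives. [cite: Federbush1988PhaseCellIV, (11.13) p. 339] -/
theorem scale_bookkeeping6 {ℓ : ℝ} (hℓ : 0 < ℓ) (C a b K : ℝ) {m : ℕ} (hm : 1 ≤ m) :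
    ℓ⁻¹ ^ m * (C * max ((ℓ⁻¹ * a)⁻¹ ^ (m - 1)) ((ℓ⁻¹ * b)⁻¹ ^ (m - 1)) * (ℓ⁻¹ * b)⁻¹ * (ℓ * K)) =
      C * max (a⁻¹ ^ (m - 1)) (b⁻¹ ^ (m - 1)) * (ℓ / b) * K := by
  obtain ⟨m, rfl⟩ := Nat.exists_eq_add_of_le' hm
  have hℓ0 : ℓ ≠ 0 := hℓ.ne'
  simp only [Nat.add_sub_cancel, mul_inv, inv_inv, mul_pow]
  rw [← mul_max_of_nonneg _ _ (pow_nonneg hℓ.le m)]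
  have h1 : ℓ⁻¹ ^ (m + 1) * (ℓ ^ m * ℓ) = 1 := by
    rw [← pow_succ, ← mul_pow, inv_mul_cancel₀ hℓ0, one_pow]
  calc _ = ℓ⁻¹ ^ (m + 1) * (ℓ ^ m * ℓ) * (C * max (a⁻¹ ^ m) (b⁻¹ ^ m) * (ℓ / b) * K) := by rw [div_eq_mul_inv]; ring
    _ = C * max (a⁻¹ ^ m) (b⁻¹ ^ m) * (ℓ / b) * K := by rw [h1, one_mul]

end Hypercube

/-- **Geometric Construction 5 at print's scale FROM the unit-scale decl of record**, same constants: `GeomConstruction5 k t M →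
GeomConstruction5Scaled k t M`.  Pull `ᵉφ′` back along `y ↦ p + ℓy` (Lipschitz constant `ℓK ≤ c₁` = the unit cap), smooth
at unit scale, push forward along `x ↦ ℓ⁻¹(x − p)`: `‖D^m‖` gains `ℓ⁻ᵐ`, `d(x, ∂H)^{−(m−1)}` gives back `ℓ^{m−1}`, `Λ₁` gives
back `ℓ` — (11.11) with no power of `L_r`, as printed. [cite: Federbush1988PhaseCellIV, Geometric Construction 5
(11.10)–(11.11) p. 338; Caution p. 339] -/
theorem GeomConstruction5.scaled {M : Set (EuclideanSpace ℝ (Fin t))} (h : GeomConstruction5 k t M) :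
    GeomConstruction5Scaled k t M := by
  intro c₁
  obtain ⟨c, hc⟩ := h c₁
  refine ⟨c, fun p ℓ hℓ eφ hK => ?_⟩
  have hℓ0 : ℓ ≠ 0 := hℓ.ne'
  -- the pulled-back datum on the unit cube
  set ψ : ↥(unitCube k) → ↥M :=
    fun y => eφ ⟨ofUnit p ℓ y.1, (mem_hypercube_iff hℓ p _).2 ((toUnit_ofUnit hℓ0 p y.1).symm ▸ y.2)⟩ with hψ
  have hψL : ∀ K : ℝ≥0, LipschitzWith K eφ → LipschitzWith (K * Real.toNNReal ℓ) ψ :=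
    fun K hK => lipschitzWith_comp_ofUnit_cube hℓ p hK
  obtain ⟨K₀, hK₀cap, hK₀L⟩ := hK
  obtain ⟨esψ, hmaps, hbd, hcont, hsmooth, hbound⟩ := hc ψ ⟨K₀ * Real.toNNReal ℓ, cap_toNNReal hℓ hK₀cap, hψL K₀ hK₀L⟩
  -- recover the datum from its pull-back
  have hψeφ : ∀ x : ↥(hypercube k p ℓ), ∀ hy : toUnit p ℓ x.1 ∈ unitCube k, ψ ⟨toUnit p ℓ x.1, hy⟩ = eφ x := by
    intro x hy
    simp only [hψ]
    congr 1
    exact Subtype.ext (ofUnit_toUnit hℓ0 p x.1)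
  refine ⟨fun x => esψ (toUnit p ℓ x), fun x hx => hmaps ((mem_hypercube_iff hℓ p x).1 hx), fun x => ?_, ?_, ?_,
    fun m hm K hKcap hKL x hx => ?_⟩
  · -- (11.10) on `∂H`
    have hy : toUnit p ℓ x.1 ∈ cubeBoundary k := (mem_hypercubeBoundary_iff hℓ p _).1 x.2
    have h1 := hbd ⟨toUnit p ℓ x.1, hy⟩
    dsimp only at h1 ⊢
    rw [h1, hψeφ ⟨x.1, hypercubeBoundary_subset k p ℓ x.2⟩ (cubeBoundary_subset k hy)]
  · -- continuity on `H`
    exact hcont.comp (continuous_toUnit p ℓ).continuousOn fun x hx => (mem_hypercube_iff hℓ p x).1 hx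
  · -- smoothness on the open hypercube
    exact hsmooth.comp (contDiff_toUnit p ℓ).contDiffOn fun x hx => (mem_interior_hypercube_iff hℓ p x).1 hx
  · -- (11.11)
    have hy : toUnit p ℓ x ∈ interior (unitCube k) := (mem_interior_hypercube_iff hℓ p x).1 hx
    have hunit := hbound m hm (K * Real.toNNReal ℓ) (cap_toNNReal hℓ hKcap) (hψL K hKL) (toUnit p ℓ x) hy
    have htrans := norm_iteratedFDeriv_comp_toUnit_le hℓ p isOpen_interior hsmooth x hy m
    have hcoe : ((K * Real.toNNReal ℓ : ℝ≥0) : ℝ) = ℓ * K := by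
      rw [NNReal.coe_mul, Real.coe_toNNReal _ hℓ.le, mul_comm]
    rw [hcoe, infDist_toUnit_cubeBoundary hℓ] at hunit
    calc ‖iteratedFDeriv ℝ m (fun y => esψ (toUnit p ℓ y)) x‖
        ≤ ℓ⁻¹ ^ m * ‖iteratedFDeriv ℝ m esψ (toUnit p ℓ x)‖ := htrans
      _ ≤ ℓ⁻¹ ^ m * (c m * (ℓ⁻¹ * infDist x (hypercubeBoundary k p ℓ))⁻¹ ^ (m - 1) * (ℓ * K)) := by gcongr
      _ = c m * (infDist x (hypercubeBoundary k p ℓ))⁻¹ ^ (m - 1) * K := scale_bookkeeping5 hℓ _ _ _ hm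

/-- **Geometric Construction 6 at print's scale FROM the unit-scale decl of record**, same constants and same centering
ratio: `GeomConstruction6 k t M δ → GeomConstruction6Scaled k t M δ`.  Under the chart `d(x₀, c(H)) ≤ δL_r` becomes `d(y₀,
c(D)) ≤ δ`, `‖D^m‖` gains `ℓ⁻ᵐ`, the `max` gives back `ℓ^{m−1}`, `1/d(y, y₀)` gives `ℓ/d(x, x₀)`, `Λ₁` gives back `ℓ`: the
powers cancel to (11.13) with exactly the printed factor `L_r/d(x, x₀)`. [cite: Federbush1988PhaseCellIV, Geometric
Construction 6 (11.12)–(11.13) p. 338–339; Centering Property p. 338; Caution p. 339] -/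
theorem GeomConstruction6.scaled {M : Set (EuclideanSpace ℝ (Fin t))} {δ : ℝ} (h : GeomConstruction6 k t M δ) :
    GeomConstruction6Scaled k t M δ := by
  intro c₁
  obtain ⟨c, hc⟩ := h c₁
  refine ⟨c, fun p ℓ hℓ x₀ hx₀ φ hK => ?_⟩
  have hℓ0 : ℓ ≠ 0 := hℓ.ne'
  -- the singular point at unit scale
  set y₀ : Euc k := toUnit p ℓ x₀ with hy₀
  have hy₀c : dist y₀ (CubeBall.center k) ≤ δ := by
    rw [hy₀, ← toUnit_center hℓ0 p, dist_toUnit hℓ]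
    calc ℓ⁻¹ * dist x₀ (p + ℓ • CubeBall.center k) ≤ ℓ⁻¹ * (δ * ℓ) := by gcongr
      _ = δ := by field_simp
  have hy₀iff : ∀ x : Euc k, toUnit p ℓ x = y₀ ↔ x = x₀ := fun x => (toUnit_injective hℓ0 p).eq_iff
  have hdist : ∀ x : Euc k, dist (toUnit p ℓ x) y₀ = ℓ⁻¹ * dist x x₀ := fun x => by rw [hy₀, dist_toUnit hℓ]
  -- the pulled-back boundary datum
  set ψ : ↥(cubeBoundary k) → ↥M :=
    fun y => φ ⟨ofUnit p ℓ y.1, (ofUnit_mem_hypercubeBoundary_iff hℓ p y.1).2 y.2⟩ with hψ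
  have hψL : ∀ K : ℝ≥0, LipschitzWith K φ → LipschitzWith (K * Real.toNNReal ℓ) ψ :=
    fun K hK => lipschitzWith_comp_ofUnit_boundary hℓ p hK
  obtain ⟨K₀, hK₀cap, hK₀L⟩ := hK
  obtain ⟨eψ, hmaps, hbd, hcont, hsmooth, hbound⟩ :=
    hc y₀ hy₀c ψ ⟨K₀ * Real.toNNReal ℓ, cap_toNNReal hℓ hK₀cap, hψL K₀ hK₀L⟩
  have hψφ : ∀ x : ↥(hypercubeBoundary k p ℓ), ∀ hy : toUnit p ℓ x.1 ∈ cubeBoundary k, ψ ⟨toUnit p ℓ x.1, hy⟩ = φ x := by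
    intro x hy
    simp only [hψ]
    congr 1
    exact Subtype.ext (ofUnit_toUnit hℓ0 p x.1)
  have hmapsD : ∀ x ∈ hypercube k p ℓ \ {x₀}, toUnit p ℓ x ∈ unitCube k \ {y₀} := fun x hx =>
    ⟨(mem_hypercube_iff hℓ p x).1 hx.1, fun h => hx.2 ((hy₀iff x).1 h)⟩
  have hmapsI : ∀ x ∈ interior (hypercube k p ℓ) \ {x₀}, toUnit p ℓ x ∈ interior (unitCube k) \ {y₀} := fun x hx =>
    ⟨(mem_interior_hypercube_iff hℓ p x).1 hx.1, fun h => hx.2 ((hy₀iff x).1 h)⟩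
  refine ⟨fun x => eψ (toUnit p ℓ x), fun x hx => hmaps (hmapsD x hx), fun x => ?_, ?_, ?_, fun m hm K hKcap hKL x hx => ?_⟩
  · -- (11.12) on `∂H`
    have hy : toUnit p ℓ x.1 ∈ cubeBoundary k := (mem_hypercubeBoundary_iff hℓ p _).1 x.2
    have h1 := hbd ⟨toUnit p ℓ x.1, hy⟩
    dsimp only at h1 ⊢
    rw [h1, hψφ x hy]
  · -- continuity on `H − x₀`
    exact hcont.comp (continuous_toUnit p ℓ).continuousOn hmapsD
  · -- smoothness on the open hypercube minus `x₀`
    exact hsmooth.comp (contDiff_toUnit p ℓ).contDiffOn hmapsI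
  · -- (11.13)
    have hy := hmapsI x hx
    have hunit := hbound m hm (K * Real.toNNReal ℓ) (cap_toNNReal hℓ hKcap) (hψL K hKL) (toUnit p ℓ x) hy
    have hopen : IsOpen (interior (unitCube k) \ {y₀}) := isOpen_interior.sdiff isClosed_singleton
    have htrans := norm_iteratedFDeriv_comp_toUnit_le hℓ p hopen hsmooth x hy m
    have hcoe : ((K * Real.toNNReal ℓ : ℝ≥0) : ℝ) = ℓ * K := by
      rw [NNReal.coe_mul, Real.coe_toNNReal _ hℓ.le, mul_comm]
    rw [hcoe, infDist_toUnit_cubeBoundary hℓ, hdist] at hunit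
    calc ‖iteratedFDeriv ℝ m (fun y => eψ (toUnit p ℓ y)) x‖
        ≤ ℓ⁻¹ ^ m * ‖iteratedFDeriv ℝ m eψ (toUnit p ℓ x)‖ := htrans
      _ ≤ ℓ⁻¹ ^ m * (c m * max ((ℓ⁻¹ * infDist x (hypercubeBoundary k p ℓ))⁻¹ ^ (m - 1)) ((ℓ⁻¹ * dist x x₀)⁻¹ ^ (m - 1)) *
            (ℓ⁻¹ * dist x x₀)⁻¹ * (ℓ * K)) := by gcongr
      _ = c m * max ((infDist x (hypercubeBoundary k p ℓ))⁻¹ ^ (m - 1)) ((dist x x₀)⁻¹ ^ (m - 1)) * (ℓ / dist x x₀) * K :=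
          scale_bookkeeping6 hℓ _ _ _ _ hm

/-! ## §4 Print's targets: compact `C^∞` submanifolds, compact (gauge) groups, spheres -/

/-- **Geometric Construction 5 at print's scale for every compact `C^∞` submanifold `M ⊂ Rᵗ`**, every `k`.
[cite: Federbush1988PhaseCellIV, Geometric Construction 5 (11.10)–(11.11) p. 338; Theorem A.3 p. 342] -/
theorem geomConstruction5Scaled_of_submanifold {d : ℕ} {M : Set (EuclideanSpace ℝ (Fin t))} (hMc : IsCompact M)
    (hM : IsSubmanifoldOfDim d (EuclideanSpace.equiv (Fin t) ℝ '' M)) (k : ℕ) : GeomConstruction5Scaled k t M :=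
  (geomConstruction5_of_submanifold hMc hM k).scaled

/-- **Geometric Construction 6 at print's scale for every compact `C^∞` submanifold `M ⊂ Rᵗ`**, every `k`, every `δ < ½`.
[cite: Federbush1988PhaseCellIV, Geometric Construction 6 (11.12)–(11.13) p. 338–339; Theorem A.4 p. 343] -/
theorem geomConstruction6Scaled_of_submanifold {d : ℕ} {M : Set (EuclideanSpace ℝ (Fin t))} (hMc : IsCompact M)
    (hM : IsSubmanifoldOfDim d (EuclideanSpace.equiv (Fin t) ℝ '' M)) (k : ℕ) {δ : ℝ} (hδ : δ < 1 / 2) :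
    GeomConstruction6Scaled k t M δ :=
  (geomConstruction6_of_submanifold hMc hM k hδ).scaled

section CompactSubgroup

variable {N : ℕ} {H : Set (Matrix (Fin N) (Fin N) ℂ)} (hHc : IsCompact H) (h1 : (1 : Matrix (Fin N) (Fin N) ℂ) ∈ H)
  (hmul : ∀ a ∈ H, ∀ b ∈ H, a * b ∈ H) (hinv : ∀ a ∈ H, ∃ b ∈ H, b * a = 1)
include hHc h1 hmul hinv

/-- **Constructions 5 and 6 at print's scale for a compact matrix group `M = Ψ(H)`**, `Ψ : M_N(ℂ) ≅ Rᵗ` real-linear.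
[cite: Federbush1988PhaseCellIV, Geometric Constructions 5–6 (11.10)–(11.13) p. 338–339; §11 p. 337 («`G`»)] -/
theorem geomConstructions56Scaled_of_isCompact_subgroup (Ψ : Matrix (Fin N) (Fin N) ℂ ≃L[ℝ] EuclideanSpace ℝ (Fin t))
    (k : ℕ) {δ : ℝ} (hδ : δ < 1 / 2) : GeomConstruction5Scaled k t (Ψ '' H) ∧ GeomConstruction6Scaled k t (Ψ '' H) δ :=
  ⟨(geomConstruction5_of_isCompact_subgroup hHc h1 hmul hinv Ψ k).scaled,
    (geomConstruction6_of_isCompact_subgroup hHc h1 hmul hinv Ψ k hδ).scaled⟩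

end CompactSubgroup

/-- **Constructions 5 and 6 at print's scale for `M = Ψ(ρ(G))`**, `G` any compact group, `ρ` any continuous matrix
representation. [cite: Federbush1988PhaseCellIV, Geometric Constructions 5–6 (11.10)–(11.13) p. 338–339; §11 p. 337] -/
theorem geomConstructions56Scaled_range_of_compact {N : ℕ} {G : Type*} [Group G] [TopologicalSpace G] [CompactSpace G]
    (ρ : G →* Matrix (Fin N) (Fin N) ℂ) (hρ : Continuous ρ) (Ψ : Matrix (Fin N) (Fin N) ℂ ≃L[ℝ] EuclideanSpace ℝ (Fin t))
    (k : ℕ) {δ : ℝ} (hδ : δ < 1 / 2) :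
    GeomConstruction5Scaled k t (Ψ '' Set.range ρ) ∧ GeomConstruction6Scaled k t (Ψ '' Set.range ρ) δ :=
  ⟨(geomConstruction5_range_of_compact ρ hρ Ψ k).scaled, (geomConstruction6_range_of_compact ρ hρ Ψ k hδ).scaled⟩

/-- **Constructions 5 and 6 at print's scale for the gauge group `U(N)`**, hypothesis-free (`δ < ½`).
[cite: Federbush1988PhaseCellIV, Geometric Constructions 5–6 (11.10)–(11.13) p. 338–339; §11 p. 337] -/
theorem geomConstructions56Scaled_unitaryGroup {N : ℕ} (Ψ : Matrix (Fin N) (Fin N) ℂ ≃L[ℝ] EuclideanSpace ℝ (Fin t)) (k : ℕ)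
    {δ : ℝ} (hδ : δ < 1 / 2) :
    GeomConstruction5Scaled k t (Ψ '' (Matrix.unitaryGroup (Fin N) ℂ : Set (Matrix (Fin N) (Fin N) ℂ))) ∧
      GeomConstruction6Scaled k t (Ψ '' (Matrix.unitaryGroup (Fin N) ℂ : Set (Matrix (Fin N) (Fin N) ℂ))) δ :=
  ⟨(geomConstruction5_unitaryGroup Ψ k).scaled, (geomConstruction6_unitaryGroup Ψ k hδ).scaled⟩

/-- **Constructions 5 and 6 at print's scale for the gauge group `SU(N)`**, hypothesis-free (`δ < ½`).
[cite: Federbush1988PhaseCellIV, Geometric Constructions 5–6 (11.10)–(11.13) p. 338–339; §11 p. 337] -/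
theorem geomConstructions56Scaled_specialUnitaryGroup {N : ℕ} (Ψ : Matrix (Fin N) (Fin N) ℂ ≃L[ℝ] EuclideanSpace ℝ (Fin t))
    (k : ℕ) {δ : ℝ} (hδ : δ < 1 / 2) :
    GeomConstruction5Scaled k t (Ψ '' (Matrix.specialUnitaryGroup (Fin N) ℂ : Set (Matrix (Fin N) (Fin N) ℂ))) ∧
      GeomConstruction6Scaled k t (Ψ '' (Matrix.specialUnitaryGroup (Fin N) ℂ : Set (Matrix (Fin N) (Fin N) ℂ))) δ :=
  ⟨(geomConstruction5_specialUnitaryGroup Ψ k).scaled, (geomConstruction6_specialUnitaryGroup Ψ k hδ).scaled⟩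

/-- **Constructions 5 and 6 at print's scale for the unit sphere `S^{t−1} ⊂ Rᵗ`** (`SU(2) = S³`, `U(1) = S¹`), hypothesis-free.
[cite: Federbush1988PhaseCellIV, Geometric Constructions 5–6 (11.10)–(11.13) p. 338–339; Theorems A.3–A.4 p. 342–343] -/
theorem geomConstructions56Scaled_sphere (k t : ℕ) {δ : ℝ} (hδ : δ < 1 / 2) :
    GeomConstruction5Scaled k t (sphere (0 : EuclideanSpace ℝ (Fin t)) 1) ∧
      GeomConstruction6Scaled k t (sphere (0 : EuclideanSpace ℝ (Fin t)) 1) δ :=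
  ⟨(geomConstruction5_sphere k t).scaled, (geomConstruction6_sphere k t hδ).scaled⟩

/-! ## §5 The lattice form: hypercubes of level `r` in `ℒ^r` (§1), `L_r = 1/N^r`, the Centering Property -/

section Lattice

open PhaseCellIVLattice

variable {d : ℕ}

/-- The level-`r` hypercube of `ℒ^r` with lowest corner the vertex `n` IS the hypercube with corner `n/N^r` and side `L_r = 1/N^r`.
[cite: Federbush1988PhaseCellIV, §1 p. 321; §11 p. 338 («`H` level `r`»)] -/
theorem cube_eq_hypercube (N r : ℕ) (n : Fin d → ℤ) : cube N r n = hypercube d (pos N r n) (edgeLen N r) :=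
  Set.ext fun _ => Iff.rfl

/-- `∂H ⊆ H` for the lattice hypercubes. [cite: Federbush1988PhaseCellIV, (11.10), (11.12) p. 338] -/
theorem frontier_cube_subset (N r : ℕ) (n : Fin d → ℤ) : frontier (cube N r n) ⊆ cube N r n := by
  rw [cube_eq_hypercube]; exact hypercubeBoundary_subset d _ _

/-- `c(H) = n/N^r + L_r·(½, …, ½)`. [cite: Federbush1988PhaseCellIV, Centering Property p. 338] -/
theorem center_eq (N r : ℕ) (n : Fin d → ℤ) : center N r n = pos N r n + edgeLen N r • CubeBall.center d := by
  ext i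
  simp only [PhaseCellIVLattice.center_apply, PiLp.add_apply, PiLp.smul_apply, pos_apply, CubeBall.center_apply, smul_eq_mul]
  ring

/-- The first clause of the Centering Property in the form the scaled construction consumes: `d(x₀, c(H)) ≤ L_{r+1} = N⁻¹·L_r`.
[cite: Federbush1988PhaseCellIV, Centering Property p. 338; §1 p. 321] -/
theorem dist_center_le_of_centeringProperty {N r : ℕ} {n : Fin d → ℤ} {x₀ : EuclideanSpace ℝ (Fin d)}
    (h : CenteringProperty N r n x₀) :
    dist x₀ (pos N r n + edgeLen N r • CubeBall.center d) ≤ (N : ℝ)⁻¹ * edgeLen N r := by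
  rw [← center_eq, ← div_eq_inv_mul, ← edgeLen_succ]
  exact h.1

/-- Print's centering ratio `L_{r+1}/L_r = 1/N` is `< ½` as soon as `N ≥ 3` (print: «We will choose `N` odd», p. 322).
[cite: Federbush1988PhaseCellIV, Centering Property p. 338; §1 p. 322] -/
theorem inv_lt_half_of_three_le {N : ℕ} (hN : 3 ≤ N) : (N : ℝ)⁻¹ < 1 / 2 := by
  have h3 : (3 : ℝ) ≤ N := by exact_mod_cast hN
  rw [inv_eq_one_div]
  exact (one_div_le_one_div_of_le (by norm_num) h3).trans_lt (by norm_num)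

/-- **Geometric Construction 6 ON THE LEVEL-`r` HYPERCUBES OF `ℒ^r`** (every `r`, every corner vertex `n`, every `x₀` with the
Centering Property), literally as printed — `H = cube N r n`, `∂H = frontier H`, `L_r = edgeLen N r`, (11.12) on `∂H`, (11.13)
with the factor `L_r/d(x, x₀)` — from `GeomConstruction6Scaled` at the ratio `δ = 1/N`.
[cite: Federbush1988PhaseCellIV, Geometric Construction 6 (11.12)–(11.13) p. 338–339; Centering Property p. 338; §1 p. 321] -/
theorem geomConstruction6_cube_of_scaled {N : ℕ} (hN : 0 < N) {M : Set (EuclideanSpace ℝ (Fin t))}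
    (h : GeomConstruction6Scaled d t M (N : ℝ)⁻¹) (c₁ : ℝ≥0) :
    ∃ c : ℕ → ℝ, ∀ (r : ℕ) (n : Fin d → ℤ) (x₀ : EuclideanSpace ℝ (Fin d)), CenteringProperty N r n x₀ →
      ∀ φ : ↥(frontier (cube N r n)) → ↥M, (∃ K : ℝ≥0, edgeLen N r * K ≤ c₁ ∧ LipschitzWith K φ) →
        ∃ eφ : EuclideanSpace ℝ (Fin d) → EuclideanSpace ℝ (Fin t),
          MapsTo eφ (cube N r n \ {x₀}) M ∧
          (∀ x : ↥(frontier (cube N r n)), eφ x = (φ x : EuclideanSpace ℝ (Fin t))) ∧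
          ContinuousOn eφ (cube N r n \ {x₀}) ∧
          ContDiffOn ℝ ∞ eφ (interior (cube N r n) \ {x₀}) ∧
          ∀ m : ℕ, 1 ≤ m → ∀ K : ℝ≥0, edgeLen N r * K ≤ c₁ → LipschitzWith K φ →
            ∀ x ∈ interior (cube N r n) \ {x₀},
              ‖iteratedFDeriv ℝ m eφ x‖ ≤
                c m * max ((infDist x (frontier (cube N r n)))⁻¹ ^ (m - 1)) ((dist x x₀)⁻¹ ^ (m - 1)) *
                  (edgeLen N r / dist x x₀) * K := by
  obtain ⟨c, hc⟩ := h c₁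
  refine ⟨c, fun r n x₀ hx₀ φ hK => ?_⟩
  have key := hc (pos N r n) (edgeLen N r) (edgeLen_pos hN r) x₀ (dist_center_le_of_centeringProperty hx₀)
  rw [← cube_eq_hypercube] at key
  exact key φ hK

/-- **Geometric Construction 5 ON THE LEVEL-`r` HYPERCUBES OF `ℒ^r`**, literally as printed (`H = cube N r n`, `∂H =
frontier H`, cap `L_r·Λ₁ ≤ c₁`, (11.11) with no power of `L_r`) — from `GeomConstruction5Scaled`.
[cite: Federbush1988PhaseCellIV, Geometric Construction 5 (11.10)–(11.11) p. 338; §1 p. 321] -/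
theorem geomConstruction5_cube_of_scaled {N : ℕ} (hN : 0 < N) {M : Set (EuclideanSpace ℝ (Fin t))}
    (h : GeomConstruction5Scaled d t M) (c₁ : ℝ≥0) :
    ∃ c : ℕ → ℝ, ∀ (r : ℕ) (n : Fin d → ℤ),
      ∀ eφ : ↥(cube N r n) → ↥M, (∃ K : ℝ≥0, edgeLen N r * K ≤ c₁ ∧ LipschitzWith K eφ) →
        ∃ esφ : EuclideanSpace ℝ (Fin d) → EuclideanSpace ℝ (Fin t),
          MapsTo esφ (cube N r n) M ∧
          (∀ x : ↥(frontier (cube N r n)), esφ x = (eφ ⟨x.1, frontier_cube_subset N r n x.2⟩ : EuclideanSpace ℝ (Fin t))) ∧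
          ContinuousOn esφ (cube N r n) ∧
          ContDiffOn ℝ ∞ esφ (interior (cube N r n)) ∧
          ∀ m : ℕ, 1 ≤ m → ∀ K : ℝ≥0, edgeLen N r * K ≤ c₁ → LipschitzWith K eφ →
            ∀ x ∈ interior (cube N r n),
              ‖iteratedFDeriv ℝ m esφ x‖ ≤ c m * ((infDist x (frontier (cube N r n)))⁻¹ ^ (m - 1)) * K := by
  obtain ⟨c, hc⟩ := h c₁
  refine ⟨c, fun r n eφ hK => ?_⟩
  exact hc (pos N r n) (edgeLen N r) (edgeLen_pos hN r) eφ hK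

/-- **Construction 6 on the lattice hypercubes for every compact `C^∞` submanifold target**, `N ≥ 3`.
[cite: Federbush1988PhaseCellIV, Geometric Construction 6 (11.12)–(11.13) p. 338–339; Centering Property p. 338; Theorem A.4
p. 343] -/
theorem geomConstruction6Scaled_lattice_of_submanifold {N : ℕ} (hN : 3 ≤ N) {e : ℕ} {M : Set (EuclideanSpace ℝ (Fin t))}
    (hMc : IsCompact M) (hM : IsSubmanifoldOfDim e (EuclideanSpace.equiv (Fin t) ℝ '' M)) (d : ℕ) :
    GeomConstruction6Scaled d t M (N : ℝ)⁻¹ :=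
  geomConstruction6Scaled_of_submanifold hMc hM d (inv_lt_half_of_three_le hN)

/-- **Construction 6 on the lattice hypercubes of `ℒ^r` for the gauge group `U(N′)`**, hypothesis-free beyond `N ≥ 3` (the
lattice parameter; print takes `N` odd): the literal (11.12)–(11.13) on `H = cube N r n` with print's `x₀`.
[cite: Federbush1988PhaseCellIV, Geometric Construction 6 (11.12)–(11.13) p. 338–339; Centering Property p. 338; §11 p. 337] -/
theorem geomConstruction6Scaled_lattice_unitaryGroup {N : ℕ} (hN : 3 ≤ N) {N' : ℕ}
    (Ψ : Matrix (Fin N') (Fin N') ℂ ≃L[ℝ] EuclideanSpace ℝ (Fin t)) (d : ℕ) :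
    GeomConstruction6Scaled d t (Ψ '' (Matrix.unitaryGroup (Fin N') ℂ : Set (Matrix (Fin N') (Fin N') ℂ))) (N : ℝ)⁻¹ :=
  (geomConstructions56Scaled_unitaryGroup Ψ d (inv_lt_half_of_three_le hN)).2

/-- Same for `SU(N′)`. [cite: Federbush1988PhaseCellIV, Geometric Construction 6 (11.12)–(11.13) p. 338–339; §11 p. 337] -/
theorem geomConstruction6Scaled_lattice_specialUnitaryGroup {N : ℕ} (hN : 3 ≤ N) {N' : ℕ}
    (Ψ : Matrix (Fin N') (Fin N') ℂ ≃L[ℝ] EuclideanSpace ℝ (Fin t)) (d : ℕ) :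
    GeomConstruction6Scaled d t (Ψ '' (Matrix.specialUnitaryGroup (Fin N') ℂ : Set (Matrix (Fin N') (Fin N') ℂ))) (N : ℝ)⁻¹ :=
  (geomConstructions56Scaled_specialUnitaryGroup Ψ d (inv_lt_half_of_three_le hN)).2

/-- **(11.12)–(11.13) LITERALLY, for the gauge group `G = U(N′)`, on every level-`r` hypercube `H` of `ℒ^r`** (`N ≥ 3`): for
every cap `c₁` there are `c_m` such that for every `r`, every `H = cube N r n`, every `x₀` with the Centering Property and every
`φ′ : ∂H → Ψ(U(N′))` with `L_r·Λ₁(φ′) ≤ c₁`, an extension `ᵉφ′` on `H − x₀` exists with (11.12) and `‖D^m ᵉφ′(x)‖ ≤ c_m ·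
max(d(x, ∂H)^{−(m−1)}, d(x, x₀)^{−(m−1)}) · (L_r/d(x, x₀)) · Λ₁` — hypothesis-free. [cite: Federbush1988PhaseCellIV, Geometric
Construction 6 (11.12)–(11.13) p. 338–339; Centering Property p. 338; §11 p. 336 («a mapping `φ : x → G`»)] -/
theorem geomConstruction6_cube_unitaryGroup {N : ℕ} (hN : 3 ≤ N) {N' : ℕ}
    (Ψ : Matrix (Fin N') (Fin N') ℂ ≃L[ℝ] EuclideanSpace ℝ (Fin t)) (d : ℕ) (c₁ : ℝ≥0) :
    ∃ c : ℕ → ℝ, ∀ (r : ℕ) (n : Fin d → ℤ) (x₀ : EuclideanSpace ℝ (Fin d)), CenteringProperty N r n x₀ →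
      ∀ φ : ↥(frontier (cube N r n)) → ↥(Ψ '' (Matrix.unitaryGroup (Fin N') ℂ : Set (Matrix (Fin N') (Fin N') ℂ))),
        (∃ K : ℝ≥0, edgeLen N r * K ≤ c₁ ∧ LipschitzWith K φ) →
        ∃ eφ : EuclideanSpace ℝ (Fin d) → EuclideanSpace ℝ (Fin t),
          MapsTo eφ (cube N r n \ {x₀}) (Ψ '' (Matrix.unitaryGroup (Fin N') ℂ : Set (Matrix (Fin N') (Fin N') ℂ))) ∧
          (∀ x : ↥(frontier (cube N r n)), eφ x = (φ x : EuclideanSpace ℝ (Fin t))) ∧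
          ContinuousOn eφ (cube N r n \ {x₀}) ∧
          ContDiffOn ℝ ∞ eφ (interior (cube N r n) \ {x₀}) ∧
          ∀ m : ℕ, 1 ≤ m → ∀ K : ℝ≥0, edgeLen N r * K ≤ c₁ → LipschitzWith K φ →
            ∀ x ∈ interior (cube N r n) \ {x₀},
              ‖iteratedFDeriv ℝ m eφ x‖ ≤
                c m * max ((infDist x (frontier (cube N r n)))⁻¹ ^ (m - 1)) ((dist x x₀)⁻¹ ^ (m - 1)) *
                  (edgeLen N r / dist x x₀) * K :=
  geomConstruction6_cube_of_scaled (by omega) (geomConstruction6Scaled_lattice_unitaryGroup hN Ψ d) c₁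

/-- Same for `G = SU(N′)`. [cite: Federbush1988PhaseCellIV, Geometric Construction 6 (11.12)–(11.13) p. 338–339; Centering
Property p. 338; §11 p. 337] -/
theorem geomConstruction6_cube_specialUnitaryGroup {N : ℕ} (hN : 3 ≤ N) {N' : ℕ}
    (Ψ : Matrix (Fin N') (Fin N') ℂ ≃L[ℝ] EuclideanSpace ℝ (Fin t)) (d : ℕ) (c₁ : ℝ≥0) :
    ∃ c : ℕ → ℝ, ∀ (r : ℕ) (n : Fin d → ℤ) (x₀ : EuclideanSpace ℝ (Fin d)), CenteringProperty N r n x₀ →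
      ∀ φ : ↥(frontier (cube N r n)) → ↥(Ψ '' (Matrix.specialUnitaryGroup (Fin N') ℂ : Set (Matrix (Fin N') (Fin N') ℂ))),
        (∃ K : ℝ≥0, edgeLen N r * K ≤ c₁ ∧ LipschitzWith K φ) →
        ∃ eφ : EuclideanSpace ℝ (Fin d) → EuclideanSpace ℝ (Fin t),
          MapsTo eφ (cube N r n \ {x₀}) (Ψ '' (Matrix.specialUnitaryGroup (Fin N') ℂ : Set (Matrix (Fin N') (Fin N') ℂ))) ∧
          (∀ x : ↥(frontier (cube N r n)), eφ x = (φ x : EuclideanSpace ℝ (Fin t))) ∧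
          ContinuousOn eφ (cube N r n \ {x₀}) ∧
          ContDiffOn ℝ ∞ eφ (interior (cube N r n) \ {x₀}) ∧
          ∀ m : ℕ, 1 ≤ m → ∀ K : ℝ≥0, edgeLen N r * K ≤ c₁ → LipschitzWith K φ →
            ∀ x ∈ interior (cube N r n) \ {x₀},
              ‖iteratedFDeriv ℝ m eφ x‖ ≤
                c m * max ((infDist x (frontier (cube N r n)))⁻¹ ^ (m - 1)) ((dist x x₀)⁻¹ ^ (m - 1)) *
                  (edgeLen N r / dist x x₀) * K :=
  geomConstruction6_cube_of_scaled (by omega) (geomConstruction6Scaled_lattice_specialUnitaryGroup hN Ψ d) c₁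

/-- **(11.10)–(11.11) LITERALLY, for `G = U(N′)`, on every level-`r` hypercube of `ℒ^r`** (every `N ≥ 1`), hypothesis-free.
[cite: Federbush1988PhaseCellIV, Geometric Construction 5 (11.10)–(11.11) p. 338; §11 p. 337] -/
theorem geomConstruction5_cube_unitaryGroup {N : ℕ} (hN : 0 < N) {N' : ℕ}
    (Ψ : Matrix (Fin N') (Fin N') ℂ ≃L[ℝ] EuclideanSpace ℝ (Fin t)) (d : ℕ) (c₁ : ℝ≥0) :
    ∃ c : ℕ → ℝ, ∀ (r : ℕ) (n : Fin d → ℤ),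
      ∀ eφ : ↥(cube N r n) → ↥(Ψ '' (Matrix.unitaryGroup (Fin N') ℂ : Set (Matrix (Fin N') (Fin N') ℂ))),
        (∃ K : ℝ≥0, edgeLen N r * K ≤ c₁ ∧ LipschitzWith K eφ) →
        ∃ esφ : EuclideanSpace ℝ (Fin d) → EuclideanSpace ℝ (Fin t),
          MapsTo esφ (cube N r n) (Ψ '' (Matrix.unitaryGroup (Fin N') ℂ : Set (Matrix (Fin N') (Fin N') ℂ))) ∧
          (∀ x : ↥(frontier (cube N r n)), esφ x = (eφ ⟨x.1, frontier_cube_subset N r n x.2⟩ : EuclideanSpace ℝ (Fin t))) ∧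
          ContinuousOn esφ (cube N r n) ∧
          ContDiffOn ℝ ∞ esφ (interior (cube N r n)) ∧
          ∀ m : ℕ, 1 ≤ m → ∀ K : ℝ≥0, edgeLen N r * K ≤ c₁ → LipschitzWith K eφ →
            ∀ x ∈ interior (cube N r n),
              ‖iteratedFDeriv ℝ m esφ x‖ ≤ c m * ((infDist x (frontier (cube N r n)))⁻¹ ^ (m - 1)) * K :=
  geomConstruction5_cube_of_scaled hN (geomConstructions56Scaled_unitaryGroup Ψ d (δ := 0) one_half_pos).1 c₁

end Lattice

/-! ## §6 The converse at `p = 0`, `ℓ = 1`: the scaled typings are EQUIVALENT to the unit-scale decls of record -/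

namespace Hypercube

/-- At corner `0` and side `1` the hypercube is the unit cube `D`. [cite: Federbush1988PhaseCellIV, §11 Caution p. 339] -/
theorem hypercube_zero_one (k : ℕ) : hypercube k 0 1 = unitCube k := by
  rw [hypercube_eq_preimage one_pos]; ext x; simp [toUnit]

/-- … and its boundary is `∂D`. [cite: Federbush1988PhaseCellIV, §11 Caution p. 339] -/
theorem hypercubeBoundary_zero_one (k : ℕ) : hypercubeBoundary k 0 1 = cubeBoundary k := by
  rw [hypercubeBoundary, hypercube_zero_one, cubeBoundary]

/-- At corner `0` and side `1` the chart is the identity. [cite: Federbush1988PhaseCellIV, §11 Caution p. 339] -/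
@[simp] theorem toUnit_zero_one (x : Euc k) : toUnit 0 1 x = x := by simp [toUnit]

end Hypercube

/-- **The scaled typing of Construction 5 implies the unit-scale decl of record** (take `p = 0`, `ℓ = L_r = 1`).
[cite: Federbush1988PhaseCellIV, Geometric Construction 5 (11.10)–(11.11) p. 338; Caution p. 339] -/
theorem GeomConstruction5Scaled.unit {M : Set (EuclideanSpace ℝ (Fin t))} (h : GeomConstruction5Scaled k t M) :
    GeomConstruction5 k t M := by
  intro c₁
  obtain ⟨c, hc⟩ := h c₁
  refine ⟨c, fun eφ hK => ?_⟩
  have hD := hypercube_zero_one k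
  have hB := hypercubeBoundary_zero_one k
  -- the datum re-typed on `hypercube k 0 1 = D`
  set eφ' : ↥(hypercube k 0 1) → ↥M := fun x => eφ ⟨x.1, hD ▸ x.2⟩ with heφ'
  have hL : ∀ K : ℝ≥0, LipschitzWith K eφ → LipschitzWith K eφ' := fun K hK =>
    LipschitzWith.of_dist_le_mul fun x y => by
      simpa [heφ', Subtype.dist_eq] using hK.dist_le_mul ⟨x.1, hD ▸ x.2⟩ ⟨y.1, hD ▸ y.2⟩
  obtain ⟨K₀, hK₀, hK₀L⟩ := hK
  obtain ⟨esφ, hmaps, hbd, hcont, hsmooth, hbound⟩ :=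
    hc 0 1 one_pos eφ' ⟨K₀, by simpa using hK₀, hL K₀ hK₀L⟩
  rw [hD] at hmaps hcont hsmooth
  refine ⟨esφ, hmaps, fun x => ?_, hcont, hsmooth, fun m hm K hKc hKL x hx => ?_⟩
  · have h1 := hbd ⟨x.1, hB.symm ▸ x.2⟩
    dsimp only at h1 ⊢
    rw [h1]
  · have h1 := hbound m hm K (by simpa using hKc) (hL K hKL) x (by rwa [hD])
    rwa [hB] at h1

/-- **The scaled typing of Construction 6 implies the unit-scale decl of record** (take `p = 0`, `ℓ = L_r = 1`; then
`L_r/d(x, x₀) = d(x, x₀)⁻¹`). [cite: Federbush1988PhaseCellIV, Geometric Construction 6 (11.12)–(11.13) p. 338–339; Caution p. 339] -/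
theorem GeomConstruction6Scaled.unit {M : Set (EuclideanSpace ℝ (Fin t))} {δ : ℝ} (h : GeomConstruction6Scaled k t M δ) :
    GeomConstruction6 k t M δ := by
  intro c₁
  obtain ⟨c, hc⟩ := h c₁
  refine ⟨c, fun x₀ hx₀ φ hK => ?_⟩
  have hD := hypercube_zero_one k
  have hB := hypercubeBoundary_zero_one k
  set φ' : ↥(hypercubeBoundary k 0 1) → ↥M := fun x => φ ⟨x.1, hB ▸ x.2⟩ with hφ'
  have hL : ∀ K : ℝ≥0, LipschitzWith K φ → LipschitzWith K φ' := fun K hK =>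
    LipschitzWith.of_dist_le_mul fun x y => by
      simpa [hφ', Subtype.dist_eq] using hK.dist_le_mul ⟨x.1, hB ▸ x.2⟩ ⟨y.1, hB ▸ y.2⟩
  obtain ⟨K₀, hK₀, hK₀L⟩ := hK
  have hx₀' : dist x₀ ((0 : Euc k) + (1 : ℝ) • CubeBall.center k) ≤ δ * 1 := by simpa using hx₀
  obtain ⟨eφ, hmaps, hbd, hcont, hsmooth, hbound⟩ :=
    hc 0 1 one_pos x₀ hx₀' φ' ⟨K₀, by simpa using hK₀, hL K₀ hK₀L⟩
  rw [hD] at hmaps hcont hsmooth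
  refine ⟨eφ, hmaps, fun x => ?_, hcont, hsmooth, fun m hm K hKc hKL x hx => ?_⟩
  · have h1 := hbd ⟨x.1, hB.symm ▸ x.2⟩
    dsimp only at h1 ⊢
    rw [h1]
  · have h1 := hbound m hm K (by simpa using hKc) (hL K hKL) x (by rwa [hD])
    rw [hB, one_div] at h1
    exact h1

/-- **EQUIVALENCE of the two typings of Construction 5.** [cite: Federbush1988PhaseCellIV, Geometric Construction 5
(11.10)–(11.11) p. 338; Caution p. 339 («as scaled to unit scale»)] -/
theorem geomConstruction5Scaled_iff {M : Set (EuclideanSpace ℝ (Fin t))} :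
    GeomConstruction5Scaled k t M ↔ GeomConstruction5 k t M :=
  ⟨GeomConstruction5Scaled.unit, GeomConstruction5.scaled⟩

/-- **EQUIVALENCE of the two typings of Construction 6** (same centering ratio `δ`). [cite: Federbush1988PhaseCellIV,
Geometric Construction 6 (11.12)–(11.13) p. 338–339; Caution p. 339 («as scaled to unit scale»)] -/
theorem geomConstruction6Scaled_iff {M : Set (EuclideanSpace ℝ (Fin t))} {δ : ℝ} :
    GeomConstruction6Scaled k t M δ ↔ GeomConstruction6 k t M δ :=
  ⟨GeomConstruction6Scaled.unit, GeomConstruction6.scaled⟩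

end PhaseCellIVGauge

end

end Literature.MathematicalPhysics.QuantumFieldTheory.Federbush1986
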